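import Literature.NumberTheory.LFunctions.RayClassSiftedSums
import Literature.NumberTheory.LFunctions.ClassGroupSieveDensity
import HarnessLib

/-!
# Counting bounds for the sieve over a congruence class group `mod 𝔪` (towards Thorner–Zaman 2017, Thm 4.1)

Topic `Literature/NumberTheory/LFunctions`, namespace `Literature.NumberTheory.LFunctions.AbelianDensity`.
Everything here is PROVED (one definition with body, theorems; no named facts).

The main term of the sifted coset sums of `RayClassSiftedSums.sifted_fiberSum_le` is
`(κ_K φ(𝔪)/(N𝔪 |G|)) / V'_𝔪(z)` with `V'_𝔪(z) = Σ_{S ∈ D_z(𝔪)} 1/N𝔡_S` over the admissible squarefree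
divisors prime to `𝔪`.  As in the tree's `ClassGroupSieveDensity.lean` (the case `𝔪 = 1`) we compare
`V'_𝔪(z)` with `V_𝔪(z) = Σ_{0 < N𝔫 ≤ z, (𝔫,𝔪)=1} 1/N𝔫` and bound the latter from below by the residue
`κ_K(𝔪) = κ_K φ(𝔪)/N𝔪` times `log z`, uniformly — the factor `φ(𝔪)/N𝔪` then CANCELS in the main term of
Theorem 4.1 (Thorner–Zaman 2017, (4-4) and the proof of Theorem 4.1, p. 1156: "`V_z ≫ κ_K φ(𝔮)/N𝔮 · log z`"):
* `rayErr K 𝔪 A m u = (1/3)|d_K| N𝔪² √N𝔪 e^{2n_K} C e^{−3u/2}` — the error of Lemma 4.4 `mod 𝔪`;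
* `residue_div_le_coprimeResidue` — `κ_K(𝔪) ≥ κ_K/N𝔪`;
* `sum_coprime_inv_le` — `V_𝔪(z) ≤ e^{n_K} V'_𝔪(z)` (`𝔫 = 𝔡_{S(𝔫)} 𝔰(𝔫)²` with `S(𝔫)` prime to `𝔪`);
* `coprimeResidue_sub_le_sum_phi`, `coprime_window_sum_ge` — the smoothed and the window sums over the
  ideals prime to `𝔪` are `≥ κ_K(𝔪) − err` resp. `≥ (2/A)(κ_K(𝔪) − err)` (principal character of Lemma 4.3);
* `coprimeResidue_mul_log_le_sum_inv` — **`V_𝔪(z) ≥ κ_K(𝔪)(log z − u₀ − (m+1)/A)/(4(m+1))`** whenever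
  `err(u₀) ≤ κ_K(𝔪)/2` and `e^{u₀ + (m+1)/A} ≤ z` (disjoint windows; no Euler–Kronecker constant needed).

## References
* [ThornerZaman2017] J. Thorner, A. Zaman, *An explicit bound for the least prime ideal in the Chebotarev
  density theorem*, Algebra Number Theory 11 (2017), §4 (proof of Theorem 4.1), Lemma 2.10, Cor. 2.9.
* [Weiss1983] A. Weiss, *The least prime ideal*, J. reine angew. Math. 338 (1983), §3, Lemma 3.7.
-/

noncomputable section

open Complex Finset IsDedekindDomain NumberField Filter
open scoped Topology

namespace Literature.NumberTheory.LFunctions.AbelianDensity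

open Literature.NumberTheory.LFunctions.WeissKernel Literature.NumberTheory.LFunctions.NumberField
  Literature.NumberTheory.Sieve.Squarefree
open scoped nonZeroDivisors _root_.NumberField Classical

variable {K : Type*} [Field K] [NumberField K] {𝔪 : Ideal (𝓞 K)}

/-! ### The error term `mod 𝔪` -/

/-- The error of Lemma 4.4 `mod 𝔪`: `err_𝔪(u) = (1/3)|d_K| N𝔪² √N𝔪 · e^{2n_K} · C · e^{−3u/2}`,
`C = majorConst A m (n_K+1)`. [cite: ThornerZaman2017, Lemma 4.4] -/
def rayErr (K : Type*) [Field K] [NumberField K] (𝔪 : Ideal (𝓞 K)) (A : ℝ) (m : ℕ) (u : ℝ) : ℝ :=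
  1 / 3 * ((((NumberField.discr K).natAbs : ℝ) * ((Ideal.absNorm 𝔪 : ℕ) : ℝ) ^ 2 *
    Real.sqrt (Ideal.absNorm 𝔪 : ℕ)) * Real.exp (2 * Module.finrank ℚ K)) *
    majorConst A m (Module.finrank ℚ K + 1) * Real.exp (-(3 / 2 * u))

/-- `err_𝔪(u) ≥ 0`. [cite: ThornerZaman2017, Lemma 4.4] -/
theorem rayErr_nonneg (𝔪 : Ideal (𝓞 K)) (A : ℝ) (m : ℕ) (u : ℝ) : 0 ≤ rayErr K 𝔪 A m u := by
  rw [rayErr]; have := majorConst_pos A m (Module.finrank ℚ K + 1); positivity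

/-- `err_𝔪` is antitone in `u`. [cite: ThornerZaman2017, Lemma 4.4] -/
theorem rayErr_antitone (𝔪 : Ideal (𝓞 K)) (A : ℝ) (m : ℕ) {u v : ℝ} (huv : u ≤ v) :
    rayErr K 𝔪 A m v ≤ rayErr K 𝔪 A m u := by
  rw [rayErr, rayErr]
  have := majorConst_pos A m (Module.finrank ℚ K + 1)
  exact mul_le_mul_of_nonneg_left (Real.exp_le_exp.mpr (by linarith)) (by positivity)

/-- The principal-character error of Lemma 4.3 is at most `err_𝔪(u)` (`N𝔪 ≤ N𝔪²`). [cite: ThornerZaman2017, Lemma 4.4] -/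
theorem principalErr_le_rayErr (h𝔪 : 𝔪 ≠ ⊥) (A : ℝ) (m : ℕ) (u : ℝ) :
    1 / 3 * ((((NumberField.discr K).natAbs : ℝ) * ((Ideal.absNorm 𝔪 : ℕ) : ℝ) *
        Real.sqrt (Ideal.absNorm 𝔪 : ℕ)) * Real.exp (2 * Module.finrank ℚ K)) *
        majorConst A m (Module.finrank ℚ K + 1) * Real.exp (-(3 / 2 * u)) ≤ rayErr K 𝔪 A m u := by
  rw [rayErr]
  have hN1 : (1 : ℝ) ≤ ((Ideal.absNorm 𝔪 : ℕ) : ℝ) := by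
    exact_mod_cast Nat.one_le_iff_ne_zero.mpr (by rwa [Ne, Ideal.absNorm_eq_zero_iff])
  have hC := (majorConst_pos A m (Module.finrank ℚ K + 1)).le
  have : ((Ideal.absNorm 𝔪 : ℕ) : ℝ) ≤ ((Ideal.absNorm 𝔪 : ℕ) : ℝ) ^ 2 := by nlinarith
  gcongr

/-! ### `κ_K(𝔪) ≥ κ_K/N𝔪` -/

/-- The product of the norms of the distinct prime divisors of `𝔪 ≠ 0` is at most `N𝔪`.
[cite: ThornerZaman2017, Lemma 4.4] -/
private theorem prod_absNorm_factors_le (h𝔪 : 𝔪 ≠ ⊥) :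
    ∏ v ∈ (Ideal.finite_factors h𝔪).toFinset, ((Ideal.absNorm v.asIdeal : ℕ) : ℝ) ≤ (Ideal.absNorm 𝔪 : ℕ) := by
  set T := (Ideal.finite_factors h𝔪).toFinset with hT
  have hTd : ∀ v ∈ T, v.asIdeal ∣ 𝔪 := fun v hv ↦ by
    rw [hT, Set.Finite.mem_toFinset, Set.mem_setOf_eq] at hv; exact hv
  have hdvd : sqfIdeal T ∣ 𝔪 := (sqfIdeal_dvd_iff T 𝔪).mpr hTd
  have hN : Ideal.absNorm (sqfIdeal T) ∣ Ideal.absNorm 𝔪 := map_dvd Ideal.absNorm hdvd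
  have hm0 : Ideal.absNorm 𝔪 ≠ 0 := by rwa [Ne, Ideal.absNorm_eq_zero_iff]
  have hle : Ideal.absNorm (sqfIdeal T) ≤ Ideal.absNorm 𝔪 := Nat.le_of_dvd (Nat.pos_of_ne_zero hm0) hN
  have hle' : ((Ideal.absNorm (sqfIdeal T) : ℕ) : ℝ) ≤ ((Ideal.absNorm 𝔪 : ℕ) : ℝ) := by exact_mod_cast hle
  have heq : ((Ideal.absNorm (sqfIdeal T) : ℕ) : ℝ) = ∏ v ∈ T, ((Ideal.absNorm v.asIdeal : ℕ) : ℝ) := by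
    rw [sqfIdeal, map_prod, Nat.cast_prod]
  rwa [heq] at hle'

/-- **`κ_K(𝔪) ≥ κ_K/N𝔪`**: `∏_{𝔭 ∣ 𝔪}(1 − N𝔭⁻¹) ≥ ∏_{𝔭∣𝔪} N𝔭⁻¹ ≥ 1/N𝔪`, so the main term `κ_K φ(𝔪)/N𝔪` of
Lemma 4.3 is at least `κ_K/N𝔪`. [cite: ThornerZaman2017, Lemma 4.3] -/
theorem residue_div_le_coprimeResidue (h𝔪 : 𝔪 ≠ ⊥) :
    dedekindZeta_residue K / (Ideal.absNorm 𝔪 : ℕ) ≤ coprimeResidue K 𝔪 h𝔪 := by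
  set T := (Ideal.finite_factors h𝔪).toFinset with hT
  have hκ := dedekindZeta_residue_pos K
  have hm0 : Ideal.absNorm 𝔪 ≠ 0 := by rwa [Ne, Ideal.absNorm_eq_zero_iff]
  have hN𝔪 : (0 : ℝ) < (Ideal.absNorm 𝔪 : ℕ) := by exact_mod_cast Nat.pos_of_ne_zero hm0
  have h2 : ∀ v : HeightOneSpectrum (𝓞 K), (2 : ℝ) ≤ (Ideal.absNorm v.asIdeal : ℕ) := fun v ↦ by
    exact_mod_cast two_le_absNorm K v
  have hprod : (∏ v ∈ T, ((Ideal.absNorm v.asIdeal : ℕ) : ℝ))⁻¹ ≤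
      ∏ v ∈ T, (1 - ((Ideal.absNorm v.asIdeal : ℕ) : ℝ)⁻¹) := by
    rw [← prod_inv_distrib]
    refine prod_le_prod (fun v _ ↦ by positivity) fun v _ ↦ ?_
    have hv := h2 v
    have hv0 : (0 : ℝ) < (Ideal.absNorm v.asIdeal : ℕ) := by linarith
    rw [inv_eq_one_div, one_sub_div hv0.ne', div_le_div_iff₀ hv0 hv0]
    nlinarith
  have hP0 : 0 < ∏ v ∈ T, ((Ideal.absNorm v.asIdeal : ℕ) : ℝ) := prod_pos fun v _ ↦ by linarith [h2 v]
  calc dedekindZeta_residue K / (Ideal.absNorm 𝔪 : ℕ)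
      ≤ dedekindZeta_residue K * (∏ v ∈ T, ((Ideal.absNorm v.asIdeal : ℕ) : ℝ))⁻¹ := by
        rw [div_eq_mul_inv]
        exact mul_le_mul_of_nonneg_left (inv_anti₀ hP0 (prod_absNorm_factors_le h𝔪)) hκ.le
    _ ≤ coprimeResidue K 𝔪 h𝔪 := by
        rw [coprimeResidue]
        exact mul_le_mul_of_nonneg_left hprod hκ.le

/-! ### `V_𝔪(z) ≤ e^{n_K} V'_𝔪(z)` -/

omit [NumberField K] in
/-- A prime dividing an ideal prime to `𝔪` does not divide `𝔪`. [cite: ThornerZaman2017, Lemma 4.6] -/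
theorem not_le_of_dvd_of_isCoprime {I : Ideal (𝓞 K)} (hI : IsCoprime I 𝔪) {v : HeightOneSpectrum (𝓞 K)}
    (hv : v.asIdeal ∣ I) : ¬ 𝔪 ≤ v.asIdeal := by
  intro hle
  have hsup : I ⊔ 𝔪 = ⊤ := Ideal.isCoprime_iff_sup_eq.mp hI
  have : I ⊔ 𝔪 ≤ v.asIdeal := sup_le (Ideal.le_of_dvd hv) hle
  rw [hsup, top_le_iff] at this
  exact v.isPrime.ne_top this

/-- **`V_𝔪(z) ≤ e^{n_K} V'_𝔪(z)`**: `Σ_{0 < N𝔫 ≤ z, (𝔫,𝔪)=1} 1/N𝔫 ≤ e^{n_K} Σ_{S ∈ D_z(𝔪)} 1/N𝔡_S`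
(`𝔫 = 𝔡_{S(𝔫)} 𝔰(𝔫)²` injectively with `S(𝔫) ∈ D_z(𝔪)` when `𝔫` is prime to `𝔪`, and `Σ N𝔰^{−2} ≤ e^{n_K}`).
[cite: ThornerZaman2017, Lemma 4.6] -/
theorem sum_coprime_inv_le {z : ℝ} (hz : 0 ≤ z) :
    ∑ I ∈ (idealsNormLE K ⌊z⌋₊).filter (fun I ↦ IsCoprime I 𝔪), (Ideal.absNorm I : ℝ)⁻¹ ≤
      Real.exp (Module.finrank ℚ K) *
        bigV (fun v : HeightOneSpectrum (𝓞 K) ↦ (Ideal.absNorm v.asIdeal : ℝ)) (admissibleCoprime K 𝔪 z) := by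
  set Nf : HeightOneSpectrum (𝓞 K) → ℝ := fun v ↦ (Ideal.absNorm v.asIdeal : ℝ) with hNf
  set g : Ideal (𝓞 K) → Finset (HeightOneSpectrum (𝓞 K)) × Ideal (𝓞 K) := fun I ↦
    if hI : I = ⊥ then (∅, ⊥) else (oddPart hI, sqPart hI) with hg
  set F : Finset (HeightOneSpectrum (𝓞 K)) × Ideal (𝓞 K) → ℝ := fun p ↦
    (1 / nrm Nf p.1) * ((Ideal.absNorm p.2 : ℝ) ^ 2)⁻¹ with hF
  have hF0 : ∀ p, 0 ≤ F p := fun p ↦ by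
    have := nrm_pos (N := Nf) one_lt_absNorm_real p.1
    rw [hF]; positivity
  set src := (idealsNormLE K ⌊z⌋₊).filter (fun I ↦ IsCoprime I 𝔪) with hsrc
  have hterm : ∀ I ∈ src, (Ideal.absNorm I : ℝ)⁻¹ = F (g I) := by
    intro I hI
    obtain ⟨hI0, -⟩ := mem_idealsNormLE.mp (mem_filter.mp hI).1
    rw [hg, hF]; dsimp only
    rw [dif_neg hI0]; dsimp only
    rw [absNorm_eq_oddPart_sqPart hI0, hNf]
    field_simp
  have hmaps : ∀ I ∈ src, g I ∈ admissibleCoprime K 𝔪 z ×ˢ idealsNormLE K ⌊z⌋₊ := by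
    intro I hI
    obtain ⟨hI1, hIc⟩ := mem_filter.mp hI
    obtain ⟨hI0, hIX⟩ := mem_idealsNormLE.mp hI1
    rw [hg]; dsimp only
    rw [dif_neg hI0, Finset.mem_product]
    refine ⟨mem_admissibleCoprime.mpr ⟨oddPart_mem_admissible hI0 (le_trans (by exact_mod_cast hIX) (Nat.floor_le hz)),
      fun v hv ↦ not_le_of_dvd_of_isCoprime hIc ?_⟩, sqPart_mem_idealsNormLE hI0 hIX⟩
    have h1 : v.asIdeal ∣ sqfIdeal (oddPart hI0) := mem_iff_dvd_sqfIdeal.mp hv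
    exact h1.trans (Dvd.intro _ (sqfIdeal_oddPart_mul_sqPart_sq hI0))
  have hinj : Set.InjOn g (src : Set (Ideal (𝓞 K))) := by
    intro I hI J hJ hIJ
    rw [Finset.mem_coe] at hI hJ
    obtain ⟨hI0, -⟩ := mem_idealsNormLE.mp (mem_filter.mp hI).1
    obtain ⟨hJ0, -⟩ := mem_idealsNormLE.mp (mem_filter.mp hJ).1
    rw [hg] at hIJ; dsimp only at hIJ
    rw [dif_neg hI0, dif_neg hJ0, Prod.mk.injEq] at hIJ
    rw [← sqfIdeal_oddPart_mul_sqPart_sq hI0, ← sqfIdeal_oddPart_mul_sqPart_sq hJ0, hIJ.1, hIJ.2]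
  calc ∑ I ∈ src, (Ideal.absNorm I : ℝ)⁻¹ = ∑ I ∈ src, F (g I) := sum_congr rfl hterm
    _ = ∑ p ∈ src.image g, F p := (sum_image fun I hI J hJ h ↦ hinj hI hJ h).symm
    _ ≤ ∑ p ∈ admissibleCoprime K 𝔪 z ×ˢ idealsNormLE K ⌊z⌋₊, F p := by
        refine sum_le_sum_of_subset_of_nonneg ?_ fun p _ _ ↦ hF0 p
        intro p hp
        obtain ⟨I, hI, rfl⟩ := mem_image.mp hp
        exact hmaps I hI
    _ = (∑ S ∈ admissibleCoprime K 𝔪 z, 1 / nrm Nf S) * ∑ 𝔰 ∈ idealsNormLE K ⌊z⌋₊, ((Ideal.absNorm 𝔰 : ℝ) ^ 2)⁻¹ := by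
        rw [sum_product, sum_mul]
        refine sum_congr rfl fun S _ ↦ ?_
        rw [mul_sum]
    _ ≤ (∑ S ∈ admissibleCoprime K 𝔪 z, 1 / nrm Nf S) * Real.exp (Module.finrank ℚ K) := by
        refine mul_le_mul_of_nonneg_left (sum_idealsNormLE_absNorm_inv_sq_le _) ?_
        exact sum_nonneg fun S _ ↦ (one_div_pos.mpr (nrm_pos one_lt_absNorm_real S)).le
    _ = Real.exp (Module.finrank ℚ K) * bigV Nf (admissibleCoprime K 𝔪 z) := by rw [bigV, mul_comm]

/-! ### The smoothed and window sums over the ideals prime to `𝔪` -/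

/-- `χ(𝔞) = 1` for the principal character: `idealPow 1 I = 1`. [cite: ThornerZaman2017, Lemma 4.3] -/
private theorem idealPow_one (I : Ideal (𝓞 K)) : idealPow K (fun _ ↦ (1 : ℂ)) I = 1 := by
  unfold idealPow
  simp

/-- **The smoothed sum over the ideals prime to `𝔪` is `≥ κ_K(𝔪) − err_𝔪(u)`** (principal character of
Lemma 4.3). [cite: ThornerZaman2017, Lemma 4.3] -/
theorem coprimeResidue_sub_le_sum_phi (h𝔪 : 𝔪 ≠ ⊥) {A : ℝ} (hA : 0 < A) {m : ℕ} (hm : Module.finrank ℚ K + 3 ≤ m)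
    (u : ℝ) :
    coprimeResidue K 𝔪 h𝔪 - rayErr K 𝔪 A m u ≤
      ∑ I ∈ (idealsNormLE K ⌊Real.exp (u + ((m : ℝ) + 1) / A)⌋₊).filter (fun I ↦ IsCoprime I 𝔪),
        ((Ideal.absNorm I : ℕ) : ℝ)⁻¹ * phi A m (u - Real.log (Ideal.absNorm I)) := by
  set X := ⌊Real.exp (u + ((m : ℝ) + 1) / A)⌋₊ with hX
  set Sr : ℝ := ∑ I ∈ (idealsNormLE K X).filter (fun I ↦ IsCoprime I 𝔪),
    ((Ideal.absNorm I : ℕ) : ℝ)⁻¹ * phi A m (u - Real.log (Ideal.absNorm I)) with hSr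
  have hS : smoothedSum (fun n ↦ ∑ I ∈ (Ideal.finite_setOf_absNorm_eq (S := 𝓞 K) n).toFinset,
      rayClassCoeff 𝔪 (fun _ ↦ (1 : ℂ)) I) A m u = ((Sr : ℝ) : ℂ) := by
    rw [smoothedSum_rayClassCoeff_eq_tsum (fun _ ↦ (1 : ℂ)) hA m u, tsum_eq_sum (s := idealsNormLE K X)]
    · rw [hSr, sum_filter, Complex.ofReal_sum]
      refine Finset.sum_congr rfl fun I hI ↦ ?_
      obtain ⟨hI0, -⟩ := mem_idealsNormLE.mp hI
      rw [rayClassCoeff]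
      by_cases hc : IsCoprime I 𝔪
      · rw [if_pos ⟨hI0, hc⟩, if_pos hc, idealPow_one]
        push_cast; ring
      · rw [if_neg (fun h ↦ hc h.2), if_neg hc]; push_cast; ring
    · intro I hI
      by_cases hI0 : I = ⊥
      · rw [hI0, rayClassCoeff_bot, zero_mul, zero_mul]
      · have hgt : X < Ideal.absNorm I := by
          by_contra hle
          exact hI (mem_idealsNormLE.mpr ⟨hI0, not_lt.mp hle⟩)
        have : Real.exp (u + ((m : ℝ) + 1) / A) < Ideal.absNorm I := (Nat.floor_lt (Real.exp_pos _).le).mp hgt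
        rw [phi_sub_log_eq_zero hA m u this]
        simp
  have hb := norm_smoothedSum_one_sub_coprimeResidue_le h𝔪 hA hm u
  rw [hS] at hb
  have h1 := (Complex.abs_re_le_norm (((Sr : ℝ) : ℂ) - (coprimeResidue K 𝔪 h𝔪 : ℂ))).trans
    (hb.trans (principalErr_le_rayErr h𝔪 A m u))
  rw [Complex.sub_re, Complex.ofReal_re, Complex.ofReal_re] at h1
  linarith [(abs_le.mp h1).1]

/-- **The window sum over the ideals prime to `𝔪`**: since `0 ≤ φ ≤ A/2` and `φ(u − log N) = 0` unless
`e^{u−(m+1)/A} ≤ N ≤ e^{u+(m+1)/A}`, `(2/A)(κ_K(𝔪) − err_𝔪(u)) ≤ Σ_{e^{u−(m+1)/A} ≤ N𝔫 ≤ e^{u+(m+1)/A}, (𝔫,𝔪)=1} 1/N𝔫`.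
[cite: ThornerZaman2017, Lemma 4.3] -/
theorem coprime_window_sum_ge (h𝔪 : 𝔪 ≠ ⊥) {A : ℝ} (hA : 0 < A) {m : ℕ} (hm : Module.finrank ℚ K + 3 ≤ m) (u : ℝ) :
    2 / A * (coprimeResidue K 𝔪 h𝔪 - rayErr K 𝔪 A m u) ≤
      ∑ I ∈ ((idealsNormLE K ⌊Real.exp (u + ((m : ℝ) + 1) / A)⌋₊).filter (fun I ↦ IsCoprime I 𝔪)).filter
          (fun I ↦ Real.exp (u - ((m : ℝ) + 1) / A) ≤ Ideal.absNorm I),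
        ((Ideal.absNorm I : ℕ) : ℝ)⁻¹ := by
  have h1 := coprimeResidue_sub_le_sum_phi h𝔪 hA hm u
  set X := ⌊Real.exp (u + ((m : ℝ) + 1) / A)⌋₊ with hX
  have h2 : ∑ I ∈ (idealsNormLE K X).filter (fun I ↦ IsCoprime I 𝔪),
      ((Ideal.absNorm I : ℕ) : ℝ)⁻¹ * phi A m (u - Real.log (Ideal.absNorm I)) ≤
      ∑ I ∈ ((idealsNormLE K X).filter (fun I ↦ IsCoprime I 𝔪)).filter
          (fun I ↦ Real.exp (u - ((m : ℝ) + 1) / A) ≤ Ideal.absNorm I),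
        ((Ideal.absNorm I : ℕ) : ℝ)⁻¹ * (A / 2) := by
    have e := Finset.sum_filter (s := (idealsNormLE K X).filter (fun I ↦ IsCoprime I 𝔪))
      (fun I ↦ Real.exp (u - ((m : ℝ) + 1) / A) ≤ Ideal.absNorm I) (fun I ↦ ((Ideal.absNorm I : ℕ) : ℝ)⁻¹ * (A / 2))
    rw [e]
    refine sum_le_sum fun I hI ↦ ?_
    obtain ⟨hI0, -⟩ := mem_idealsNormLE.mp (mem_filter.mp hI).1
    have hN : (0 : ℝ) < (Ideal.absNorm I : ℕ) := by
      exact_mod_cast Nat.pos_of_ne_zero (mt Ideal.absNorm_eq_zero_iff.mp hI0)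
    split_ifs with hw
    · exact mul_le_mul_of_nonneg_left (phi_le hA m _) (by positivity)
    · rw [not_le] at hw
      have hlog : Real.log (Ideal.absNorm I : ℕ) < u - ((m : ℝ) + 1) / A := by
        rw [← Real.exp_lt_exp, Real.exp_log hN]; exact_mod_cast hw
      have hk : 0 < ((m : ℝ) + 1) / A := by positivity
      rw [phi_eq_zero_of_lt hA m (by rw [abs_of_pos (by linarith)]; linarith), mul_zero]
  have h3 := h1.trans h2
  rw [← sum_mul] at h3
  rw [div_mul_eq_mul_div, div_le_iff₀ hA]
  linarith

/-! ### `V_𝔪(z) ≫ κ_K(𝔪) log z` by disjoint windows -/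

/-- **`V_𝔪(z) ≥ κ_K(𝔪) (log z − u₀ − (m+1)/A)/(4(m+1))`** whenever `err_𝔪(u₀) ≤ κ_K(𝔪)/2` and
`e^{u₀+(m+1)/A} ≤ z`: sum `coprime_window_sum_ge` over the disjoint-up-to-endpoints windows centred at
`u₀ + 2j(m+1)/A` inside `N𝔫 ≤ z` (each ideal lies in at most two windows; `κ_K(𝔪) = κ_K φ(𝔪)/N𝔪`).
[cite: ThornerZaman2017, Lemma 2.10] -/
theorem coprimeResidue_mul_log_le_sum_inv (h𝔪 : 𝔪 ≠ ⊥) {A : ℝ} (hA : 0 < A) {m : ℕ}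
    (hm : Module.finrank ℚ K + 3 ≤ m) {u₀ : ℝ} (hu₀ : rayErr K 𝔪 A m u₀ ≤ coprimeResidue K 𝔪 h𝔪 / 2)
    {z : ℝ} (hz : Real.exp (u₀ + ((m : ℝ) + 1) / A) ≤ z) :
    coprimeResidue K 𝔪 h𝔪 * (Real.log z - u₀ - ((m : ℝ) + 1) / A) / (4 * ((m : ℝ) + 1)) ≤
      ∑ I ∈ (idealsNormLE K ⌊z⌋₊).filter (fun I ↦ IsCoprime I 𝔪), ((Ideal.absNorm I : ℕ) : ℝ)⁻¹ := by
  set κ := coprimeResidue K 𝔪 h𝔪 with hκ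
  set δ : ℝ := ((m : ℝ) + 1) / A with hδ
  have hδ0 : 0 < δ := by positivity
  have hz0 : 0 < z := lt_of_lt_of_le (Real.exp_pos _) hz
  have hLz : u₀ + δ ≤ Real.log z := by rw [← Real.exp_le_exp, Real.exp_log hz0]; exact hz
  set L : ℝ := Real.log z - u₀ - δ with hL
  have hL0 : 0 ≤ L := by rw [hL]; linarith
  set J : ℕ := ⌊L / (2 * δ)⌋₊ + 1 with hJ
  set uj : ℕ → ℝ := fun j ↦ u₀ + 2 * j * δ with huj
  set tgt := (idealsNormLE K ⌊z⌋₊).filter (fun I ↦ IsCoprime I 𝔪) with htgt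
  -- each window
  have hwin : ∀ j : ℕ, j < J → κ / A ≤
      ∑ I ∈ tgt.filter (fun I ↦ |Real.log (Ideal.absNorm I : ℕ) - uj j| ≤ δ), ((Ideal.absNorm I : ℕ) : ℝ)⁻¹ := by
    intro j hj
    have hj' : (j : ℝ) ≤ L / (2 * δ) := by
      have : j ≤ ⌊L / (2 * δ)⌋₊ := by omega
      exact le_trans (by exact_mod_cast this) (Nat.floor_le (by positivity))
    have hujle : uj j + δ ≤ Real.log z := by
      rw [huj]; dsimp only
      have : 2 * (j : ℝ) * δ ≤ L := by
        rw [le_div_iff₀ (by positivity)] at hj'; linarith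
      rw [hL] at this; linarith
    have hu0j : u₀ ≤ uj j := by
      rw [huj]; dsimp only
      have : (0 : ℝ) ≤ 2 * j * δ := by positivity
      linarith
    have hw := coprime_window_sum_ge h𝔪 hA hm (uj j)
    have hlow : κ / A ≤ 2 / A * (κ - rayErr K 𝔪 A m (uj j)) := by
      have herr := rayErr_antitone (K := K) 𝔪 A m hu0j
      have h2 : κ ≤ 2 * (κ - rayErr K 𝔪 A m (uj j)) := by linarith
      rw [div_mul_eq_mul_div, div_le_div_iff₀ hA hA]
      exact mul_le_mul_of_nonneg_right h2 hA.le
    refine hlow.trans (hw.trans ?_)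
    refine sum_le_sum_of_subset_of_nonneg ?_ fun I _ _ ↦ by positivity
    intro I hI
    rw [mem_filter] at hI ⊢
    obtain ⟨hI1, hI2⟩ := hI
    obtain ⟨hI1', hIc⟩ := mem_filter.mp hI1
    obtain ⟨hI0, hIX⟩ := mem_idealsNormLE.mp hI1'
    have hN : (0 : ℝ) < (Ideal.absNorm I : ℕ) := by
      exact_mod_cast Nat.pos_of_ne_zero (mt Ideal.absNorm_eq_zero_iff.mp hI0)
    have hup : ((Ideal.absNorm I : ℕ) : ℝ) ≤ Real.exp (uj j + δ) := by
      refine le_trans ?_ (Nat.floor_le (Real.exp_pos _).le)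
      have : ((m : ℝ) + 1) / A = δ := rfl
      rw [this] at hIX
      exact_mod_cast hIX
    refine ⟨mem_filter.mpr ⟨mem_idealsNormLE.mpr ⟨hI0, ?_⟩, hIc⟩, ?_⟩
    · rw [Nat.le_floor_iff hz0.le]
      refine hup.trans ?_
      rw [← Real.exp_log hz0]
      exact Real.exp_le_exp.mpr hujle
    · rw [abs_le]
      constructor
      · have := Real.log_le_log (Real.exp_pos _) hI2
        rw [Real.log_exp] at this; linarith
      · have := Real.log_le_log hN hup
        rw [Real.log_exp] at this; linarith
  -- sum over the windows, each ideal at most twice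
  have hsum : ∑ j ∈ Finset.range J,
      ∑ I ∈ tgt.filter (fun I ↦ |Real.log (Ideal.absNorm I : ℕ) - uj j| ≤ δ), ((Ideal.absNorm I : ℕ) : ℝ)⁻¹ ≤
        2 * ∑ I ∈ tgt, ((Ideal.absNorm I : ℕ) : ℝ)⁻¹ := by
    simp_rw [sum_filter]
    rw [sum_comm, mul_sum]
    refine sum_le_sum fun I _ ↦ ?_
    rw [← sum_filter, sum_const, nsmul_eq_mul]
    refine mul_le_mul_of_nonneg_right ?_ (by positivity)
    have := card_filter_abs_sub_le_two (u₀ := u₀) (t := Real.log (Ideal.absNorm I : ℕ)) hδ0 J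
    have e : (Finset.range J).filter (fun a ↦ |Real.log (Ideal.absNorm I : ℕ) - uj a| ≤ δ) =
        (Finset.range J).filter (fun j : ℕ ↦ |Real.log (Ideal.absNorm I : ℕ) - (u₀ + 2 * j * δ)| ≤ δ) := rfl
    rw [e]
    exact_mod_cast this
  have hJsum : (J : ℝ) * (κ / A) ≤ ∑ j ∈ Finset.range J,
      ∑ I ∈ tgt.filter (fun I ↦ |Real.log (Ideal.absNorm I : ℕ) - uj j| ≤ δ), ((Ideal.absNorm I : ℕ) : ℝ)⁻¹ := by
    have := sum_le_sum fun j (hj : j ∈ Finset.range J) ↦ hwin j (mem_range.mp hj)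
    rwa [sum_const, card_range, nsmul_eq_mul] at this
  have hJge : L / (2 * δ) ≤ J := by
    rw [hJ]; push_cast
    exact (Nat.lt_floor_add_one _).le
  have hκ0 : 0 < κ := coprimeResidue_pos h𝔪
  have e : κ * L / (4 * ((m : ℝ) + 1)) = (L / (2 * δ)) * (κ / A) / 2 := by
    rw [hδ]; field_simp; ring
  rw [e]
  have h1 : (L / (2 * δ)) * (κ / A) / 2 ≤ (J : ℝ) * (κ / A) / 2 := by
    have : 0 ≤ κ / A := by positivity
    nlinarith
  linarith

end Literature.NumberTheory.LFunctions.AbelianDensity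

end
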